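import Mathlib
import Summits.MatrixMultiplication.MatrixMultiplication.Theses.LevelGradedCohnUmans
import Literature.NumberTheory.DiophantineGeometry.FirstRowPeeling
import Literature.RepresentationTheory.FiniteGroups.VershikKerovMaxDegreeProofs

/-!
# `SnLevelDesigns` (stmt-MatrixMultiplication-7613), line `garnir-annihilator`:
# K6 `stub_levelDimUpper` — the level dimension upper bound `D_k(n) ≤ 2 · C(n,k)² · k!`

Crux `Summit.MatrixMultiplication.MatrixMultiplication.Theses.LevelGradedCohnUmans.SnLevelDesigns`;
skeleton `Cruxes/SnLevelDesigns/Lines/garnir_annihilator.lean` (lead c3 reshape 8, registered stub K6);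
this file proves the registered stub `stub_levelDimUpper` verbatim and lands
`--supports stmt-MatrixMultiplication-7613`. It is the upper companion of S5h (b)
(`frh_exp_mul_choose_sq_mul_factorial_le_sum`: `e^{-2} C(n,k)² k! ≤ D_k(n)`).

`D_k(n) = ∑_{μ ⊢ n, μ₁ ≥ n-k} (f^μ)²`. Proof: fibre the sum by `j = n - μ₁ ∈ [0, k]`. Every `μ ⊢ n` with
`μ₁ = a = n - j` is `(a, ν)` for the partition `ν ⊢ j` obtained by erasing one part `a`, and `ν ↦ (a, ν)` is
injective, so by first-row peeling (`numStandardTableaux_le_choose_mul`: `f^{(a,ν)} ≤ C(n,j) f^ν`, valid as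
`a ≥ j`) and the Burnside identity `∑_{ν ⊢ j} (f^ν)² = j!` (`sum_sq_numStandardTableaux`) the `j`-th fibre
contributes at most `T_j := C(n,j)² j!`. For `3k ≤ n` and `j < k` one has `4 T_j ≤ T_{j+1}`
(`C(n,j+1)(j+1) = C(n,j)(n-j)` and `(n-j)² ≥ (2j+3)² ≥ 4(j+1)`), whence `3 ∑_{j ≤ m} T_j ≤ 4 T_m` by
induction on `m ≤ k`, and `∑_{j ≤ k} T_j ≤ (4/3) T_k ≤ 2 T_k`.
-/

set_option linter.dupNamespace false

namespace Summit.MatrixMultiplication.MatrixMultiplication.Theorems.SnLevelDesigns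

open scoped BigOperators
open Literature.NumberTheory.DiophantineGeometry
open Literature.RepresentationTheory.FiniteGroups

/-- The ratio step `4 · C(n,j)² j! ≤ C(n,j+1)² (j+1)!` whenever `3(j+1) ≤ n`: multiply by `j + 1` and use
`C(n,j+1)(j+1) = C(n,j)(n-j)` (`Nat.choose_succ_right_eq`) with `4(j+1) ≤ (2j+3)² ≤ (n-j)²`. -/
theorem ldu_four_mul_term_le {n j : ℕ} (h : 3 * (j + 1) ≤ n) :
    4 * (n.choose j ^ 2 * j.factorial) ≤ n.choose (j + 1) ^ 2 * (j + 1).factorial := by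
  have key : n.choose (j + 1) * (j + 1) = n.choose j * (n - j) := Nat.choose_succ_right_eq n j
  have h4 : 4 * (j + 1) ≤ (n - j) ^ 2 := by
    have h1 : 2 * j + 3 ≤ n - j := by omega
    calc 4 * (j + 1) ≤ (2 * j + 3) ^ 2 := by nlinarith
      _ ≤ (n - j) ^ 2 := Nat.pow_le_pow_left h1 2
  refine Nat.le_of_mul_le_mul_right ?_ (Nat.succ_pos j)
  calc 4 * (n.choose j ^ 2 * j.factorial) * (j + 1)
      = 4 * (j + 1) * (n.choose j ^ 2 * j.factorial) := by ring
    _ ≤ (n - j) ^ 2 * (n.choose j ^ 2 * j.factorial) := Nat.mul_le_mul_right _ h4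
    _ = (n.choose j * (n - j)) ^ 2 * j.factorial := by ring
    _ = (n.choose (j + 1) * (j + 1)) ^ 2 * j.factorial := by rw [key]
    _ = n.choose (j + 1) ^ 2 * (j + 1).factorial * (j + 1) := by
        rw [Nat.factorial_succ]
        ring

/-- Geometric accumulation in `ℕ`: `3 ∑_{j ≤ m} C(n,j)² j! ≤ 4 C(n,m)² m!` for `m ≤ k`, `3k ≤ n`
(induction on `m`, each step by `ldu_four_mul_term_le`). -/
theorem ldu_three_mul_sum_le {n k : ℕ} (hk : 3 * k ≤ n) {m : ℕ} (hm : m ≤ k) :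
    3 * ∑ j ∈ Finset.range (m + 1), n.choose j ^ 2 * j.factorial ≤
      4 * (n.choose m ^ 2 * m.factorial) := by
  induction m with
  | zero => simp
  | succ m ih =>
    rw [Finset.sum_range_succ, mul_add]
    have h1 := ih (Nat.le_of_succ_le hm)
    have h2 := ldu_four_mul_term_le (n := n) (j := m) (by omega)
    omega

/-- The largest part of `μ ⊢ n` is at most `n`. -/
theorem ldu_sup_parts_le {n : ℕ} (μ : Nat.Partition n) : μ.parts.sup ≤ n :=
  Multiset.sup_le.2 fun _ hb => Nat.Partition.le_of_mem_parts hb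

/-- For `n ≠ 0` the largest part of `μ ⊢ n` is one of its parts. -/
theorem ldu_sup_mem_parts {n : ℕ} (μ : Nat.Partition n) (hn : n ≠ 0) : μ.parts.sup ∈ μ.parts := by
  -- adapted from Literature/NumberTheory/DiophantineGeometry/FirstRowPeeling.lean
  -- (`exists_sortedParts_eq_sup_cons`)
  have hp : μ.parts ≠ 0 := fun h0 => hn (by rw [← μ.parts_sum, h0, Multiset.sum_zero])
  obtain ⟨b, hb, h⟩ := Finset.exists_mem_eq_sup μ.parts.toFinset
    (Multiset.toFinset_nonempty.mpr hp) id
  have hsup : μ.parts.toFinset.sup id = μ.parts.sup := by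
    rw [Finset.sup_def, Multiset.map_id]
    exact Multiset.sup_dedup μ.parts
  rw [← hsup, h]
  exact Multiset.mem_toFinset.mp hb

/-- **The fibre bound** `∑_{μ ⊢ n, μ₁ = a} (f^μ)² ≤ C(n,j)² · j!` for `a + j = n`, `0 < a`, `j ≤ a`:
the shapes with largest part `a` are among the `(a, ν)`, `ν ⊢ j` (erase one part `a`), the map
`ν ↦ (a, ν)` is injective, `f^{(a,ν)} ≤ C(n,j) f^ν` (`numStandardTableaux_le_choose_mul`), and
`∑_{ν ⊢ j} (f^ν)² = j!` (`sum_sq_numStandardTableaux`). -/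
theorem ldu_fiber_le {n j a : ℕ} (han : a + j = n) (hja : j ≤ a) (ha : 0 < a) :
    ∑ μ ∈ Finset.univ.filter (fun μ : Nat.Partition n => μ.parts.sup = a),
        numStandardTableaux μ ^ 2 ≤ n.choose j ^ 2 * j.factorial := by
  -- adapted from Summits/MatrixMultiplication/MatrixMultiplication/Theorems/
  -- LevelGradedCohnUmansSnLevelDesignsStubFirstRowHooks.lean (the shapes `(a, ν)`, `ν ⊢ k`)
  set Φ : Nat.Partition j → Nat.Partition n := fun ν =>
    ⟨a ::ₘ ν.parts, fun {i} hi => by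
      rcases Multiset.mem_cons.1 hi with rfl | hi
      · exact ha
      · exact ν.parts_pos hi, by rw [Multiset.sum_cons, ν.parts_sum, han]⟩ with hΦ
  have hΦparts : ∀ ν, (Φ ν).parts = a ::ₘ ν.parts := fun ν => rfl
  have hle : ∀ (ν : Nat.Partition j), ∀ b ∈ ν.parts, b ≤ a := fun ν b hb =>
    (Nat.Partition.le_of_mem_parts hb).trans hja
  have hΦinj : Function.Injective Φ := fun ν₁ ν₂ h =>
    Nat.Partition.ext ((Multiset.cons_inj_right a).1 (by rw [← hΦparts, ← hΦparts, h]))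
  have hΦf : ∀ ν, numStandardTableaux (Φ ν) ≤ n.choose j * numStandardTableaux ν := fun ν =>
    numStandardTableaux_le_choose_mul (sortedParts_eq_cons (Φ ν) ν (hΦparts ν) (hle ν))
  have hn : n ≠ 0 := by omega
  -- every shape with largest part `a` is an `(a, ν)`
  have himage : Finset.univ.filter (fun μ : Nat.Partition n => μ.parts.sup = a) ⊆
      Finset.univ.image Φ := by
    intro μ hμ
    have hm : a ∈ μ.parts := by
      have h := ldu_sup_mem_parts μ hn
      rwa [(Finset.mem_filter.1 hμ).2] at h
    have hsum : (μ.parts.erase a).sum = j := by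
      have h1 := congrArg Multiset.sum (Multiset.cons_erase hm)
      rw [Multiset.sum_cons, μ.parts_sum] at h1
      omega
    refine Finset.mem_image.2 ⟨⟨μ.parts.erase a, fun {i} hi =>
      μ.parts_pos (Multiset.mem_of_mem_erase hi), hsum⟩, Finset.mem_univ _, ?_⟩
    exact Nat.Partition.ext (by rw [hΦparts]; exact Multiset.cons_erase hm)
  calc ∑ μ ∈ Finset.univ.filter (fun μ : Nat.Partition n => μ.parts.sup = a),
        numStandardTableaux μ ^ 2
      ≤ ∑ μ ∈ Finset.univ.image Φ, numStandardTableaux μ ^ 2 :=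
        Finset.sum_le_sum_of_subset himage
    _ = ∑ ν : Nat.Partition j, numStandardTableaux (Φ ν) ^ 2 := by
        rw [Finset.sum_image fun ν₁ _ ν₂ _ h => hΦinj h]
    _ ≤ ∑ ν : Nat.Partition j, n.choose j ^ 2 * numStandardTableaux ν ^ 2 :=
        Finset.sum_le_sum fun ν _ => by
          calc numStandardTableaux (Φ ν) ^ 2 ≤ (n.choose j * numStandardTableaux ν) ^ 2 :=
                Nat.pow_le_pow_left (hΦf ν) 2
            _ = n.choose j ^ 2 * numStandardTableaux ν ^ 2 := mul_pow _ _ _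
    _ = n.choose j ^ 2 * j.factorial := by
        rw [← Finset.mul_sum, sum_sq_numStandardTableaux]

/-- **`stub_levelDimUpper`** (registered stub K6 of crux stmt-MatrixMultiplication-7613, line
`garnir-annihilator`, lead c3 reshape 8; verbatim). **`D_k(n) = ∑_{μ ⊢ n, μ₁ ≥ n-k} (f^μ)² ≤ 2 C(n,k)² k!`
for `3k ≤ n`.** Fibre by `j = n - μ₁ ≤ k` (`Finset.sum_fiberwise_of_maps_to`); the `j`-th fibre is at most
`C(n,j)² j!` (`ldu_fiber_le`, first-row peeling and the Burnside identity); and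
`∑_{j ≤ k} C(n,j)² j! ≤ (4/3) C(n,k)² k!` (`ldu_three_mul_sum_le`). The case `n = 0` (so `k = 0`) is the single
empty shape, `(f^∅)² = 0! = 1 ≤ 2`. -/
theorem stub_levelDimUpper :
    ∀ (n k : ℕ), 3 * k ≤ n →
      (∑ μ : Nat.Partition n, if n - k ≤ μ.parts.sup then
          Literature.NumberTheory.DiophantineGeometry.numStandardTableaux μ ^ 2 else 0) ≤
        2 * n.choose k ^ 2 * k.factorial := by
  intro n k hk
  rcases Nat.eq_zero_or_pos n with hn0 | hn
  · subst hn0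
    obtain rfl : k = 0 := by omega
    calc (∑ μ : Nat.Partition 0, if 0 - 0 ≤ μ.parts.sup then numStandardTableaux μ ^ 2 else 0)
        ≤ ∑ μ : Nat.Partition 0, numStandardTableaux μ ^ 2 :=
          Finset.sum_le_sum fun μ _ => by split_ifs <;> simp
      _ ≤ 2 * Nat.choose 0 0 ^ 2 * Nat.factorial 0 := by
          rw [sum_sq_numStandardTableaux]
          simp
  · rw [← Finset.sum_filter]
    have hmaps : ∀ μ ∈ Finset.univ.filter (fun μ : Nat.Partition n => n - k ≤ μ.parts.sup),
        n - μ.parts.sup ∈ Finset.range (k + 1) := by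
      intro μ hμ
      rw [Finset.mem_range]
      have h := (Finset.mem_filter.1 hμ).2
      omega
    rw [← Finset.sum_fiberwise_of_maps_to hmaps]
    have hinner : ∀ j ∈ Finset.range (k + 1),
        ∑ μ ∈ Finset.univ.filter (fun μ : Nat.Partition n => n - k ≤ μ.parts.sup) with
            n - μ.parts.sup = j, numStandardTableaux μ ^ 2 ≤
          n.choose j ^ 2 * j.factorial := by
      intro j hj
      rw [Finset.mem_range] at hj
      calc ∑ μ ∈ Finset.univ.filter (fun μ : Nat.Partition n => n - k ≤ μ.parts.sup) with
              n - μ.parts.sup = j, numStandardTableaux μ ^ 2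
          ≤ ∑ μ ∈ Finset.univ.filter (fun μ : Nat.Partition n => μ.parts.sup = n - j),
              numStandardTableaux μ ^ 2 := by
            refine Finset.sum_le_sum_of_subset fun μ hμ => ?_
            have hsup := ldu_sup_parts_le μ
            simp only [Finset.mem_filter, Finset.mem_univ, true_and] at hμ ⊢
            omega
        _ ≤ n.choose j ^ 2 * j.factorial := ldu_fiber_le (by omega) (by omega) (by omega)
    calc ∑ j ∈ Finset.range (k + 1),
          ∑ μ ∈ Finset.univ.filter (fun μ : Nat.Partition n => n - k ≤ μ.parts.sup) with
            n - μ.parts.sup = j, numStandardTableaux μ ^ 2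
        ≤ ∑ j ∈ Finset.range (k + 1), n.choose j ^ 2 * j.factorial := Finset.sum_le_sum hinner
      _ ≤ 2 * n.choose k ^ 2 * k.factorial := by
          have h := ldu_three_mul_sum_le hk le_rfl
          rw [mul_assoc]
          omega

end Summit.MatrixMultiplication.MatrixMultiplication.Theorems.SnLevelDesigns
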